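import Literature.NumberTheory.EllipticCurves.ModularParamFormalXCoordProofs
import Literature.NumberTheory.EllipticCurves.EichlerShimuraCongruenceHondaProofs
import HarnessLib

/-!
# Bounded denominators of the `x`-coordinate along the modular parametrisation, over `ℚ`
# (the `(x, y)`-dictionary for `z_L`, descended; proofs only)

Topic `NumberTheory/EllipticCurves`; a proofs-only file (theorems only, no definitions, no named
facts). The `ℚ`-level companion of `ModularParamFormalXCoordProofs`, in the shape of
`HondaCongruence.exists_rat_series_formalLog_subst_eq` (`EichlerShimuraCongruenceHondaProofs`):
for a nonzero `f ∈ S₂(Γ₀(N))` with integral coefficients `aₙ`, a period pair `L` with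
`Λ(L) ⊇ Λ_f`, `g₂(L) = −4a₄`, `g₃(L) = −4a₆`, `a₄, a₆ ∈ ℚ`, and `E : y² = x³ + a₄x + a₆` over `ℚ`,
there is ONE `z ∈ qℚ⟦q⟧` with

* `log_E(z) = Σ aₙ qⁿ/n`,
* bounded denominators of `z`: `z·Q = P`, `P, Q ∈ ℤ⟦q⟧`, `Q ≠ 0`, and
* bounded denominators of the pole-cleared `x`-coordinate `X_E(z) = z²x(z)` of the formal point
  of parameter `z`: `X_E(z)·Q₂ = P₂`, `P₂, Q₂ ∈ ℤ⟦q⟧`, `Q₂ ≠ 0`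

(`exists_rat_series_formalLog_subst_eq_and_formalXMulSq`). The third item is the descent of
`q-exp(G)·X_E(z) = z²·q-exp(F)` (`IsXPresentation.exists_formalLog_subst_eq_and_formalXMulSq`)
along a RATIONAL presentation `x·q-exp(G₁) = q-exp(F₁)`, `D₁q-exp(G₁), D₂q-exp(F₁) ∈ ℤ⟦q⟧`
(`IsXPresentation.exists_rat_presentation`): `q-exp(G₁)·X_E(z) = z²·q-exp(F₁)`, whence with
`z·Q = P`: `X_E(z) · (D₂·(D₁q-exp G₁)·Q²) = D₁·(D₂q-exp F₁)·P²`. Since `w = z³/X_E(z)`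
(`formalXMulSq_mul_formalW`), the `w`-coordinate and therefore the parameter
`θ_C(z) = u(z − r w(z))/(1 + sz + (t − sr)w(z))` of every `ℚ`-model `C • E` (`formalVariableChange`)
have bounded denominators too — the modular input of the finite-height route to the integrality of
the Manin constant at `p = 2, 3` (`NeronIsogenyScaling.lean`, (m4)).

## References

* T. Honda, *On the theory of commutative formal groups*, J. Math. Soc. Japan 22 (1970), §6.2
  (pp. 241–242: "for `p ∉ S′` the local parameter has `p`-integral coefficients"). [Honda1970]
* G. Shimura, *Introduction to the arithmetic theory of automorphic functions* (1971), Thm. 3.52,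
  Thm. 7.14. [ShimuraIATAF1971]
-/

noncomputable section

open Complex Filter Topology Set Function PowerSeries
open UpperHalfPlane hiding I
open scoped Real Topology Manifold MatrixGroups PeriodPair ModularForm WithZero
open ModularForm CongruenceSubgroup

open Literature.NumberTheory.EllipticCurves Literature.NumberTheory.EllipticCurves.ModularForms

namespace Literature.NumberTheory.EllipticCurves.HondaCongruence

/-- **The local parameter at `∞` with bounded denominators of `z` AND of `X_E(z)`.** For a nonzero
`f ∈ S₂(Γ₀(N))` with integral coefficients `aₙ`, a period pair `L` with `Λ(L) ⊇ Λ_f` and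
`g₂(L) = −4a₄`, `g₃(L) = −4a₆`, `a₄, a₆ ∈ ℚ`, there are `z ∈ ℚ⟦q⟧` with `z(0) = 0` and
`P, Q, P₂, Q₂ ∈ ℤ⟦q⟧`, `Q, Q₂ ≠ 0`, with `z·Q = P`, `X_E(z)·Q₂ = P₂` for the pole-cleared formal
`x`-coordinate `X_E = formalXMulSq` of `E : y² = x³ + a₄x + a₆` over `ℚ`, and
`log_E(z) = Σ aₙ qⁿ/n`. [cite: Honda1970, §6.2 (pp. 241–242)] [cite: ShimuraIATAF1971, Thm. 3.52 and Thm. 7.14] -/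
theorem exists_rat_series_formalLog_subst_eq_and_formalXMulSq {N : ℕ} [NeZero N]
    (f : CuspForm (Gamma0 N) 2) (hf : f ≠ 0)
    (a : ℕ → ℤ) (ha : ∀ n, (a n : ℂ) = cuspCoeff f n) (L : PeriodPair)
    (hΛ : ∀ x ∈ periodLattice f, x ∈ L.lattice) (a₄ a₆ : ℚ) (h₂ : L.g₂ = -4 * (a₄ : ℂ))
    (h₃ : L.g₃ = -4 * (a₆ : ℂ)) :
    ∃ (z : ℚ⟦X⟧) (P Q P₂ Q₂ : ℤ⟦X⟧), constantCoeff z = 0 ∧ Q ≠ 0 ∧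
      z * Q.map (Int.castRingHom ℚ) = P.map (Int.castRingHom ℚ) ∧ Q₂ ≠ 0 ∧
      ({ a₁ := 0, a₂ := 0, a₃ := 0, a₄ := a₄, a₆ := a₆ } : WeierstrassCurve ℚ).formalXMulSq.subst z *
          Q₂.map (Int.castRingHom ℚ) = P₂.map (Int.castRingHom ℚ) ∧
      ({ a₁ := 0, a₂ := 0, a₃ := 0, a₄ := a₄, a₆ := a₆ } : WeierstrassCurve ℚ).formalLog.subst z =
        PowerSeries.mk fun n ↦ (a n : ℚ) / n := by
  classical
  obtain ⟨k, F, G, hk, hX⟩ := exists_isXPresentation f hf L hΛ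
  obtain ⟨zc, hzc0, hzy, hlog, hXE⟩ := hX.exists_formalLog_subst_eq_and_formalXMulSq hf h₂ h₃
  have hint : ∀ n, ∃ m : ℤ, (m : ℂ) = cuspCoeff f n := fun n => ⟨a n, ha n⟩
  have hrat : ∀ n, ∃ q : ℚ, (q : ℂ) = cuspCoeff f n := fun n ↦
    ⟨(a n : ℚ), by rw [← ha n, Rat.cast_intCast]⟩
  have hg₂ : ∃ q : ℚ, (q : ℂ) = L.g₂ := ⟨-4 * a₄, by push_cast; exact h₂.symm⟩
  have hg₃ : ∃ q : ℚ, (q : ℂ) = L.g₃ := ⟨-4 * a₆, by push_cast; exact h₃.symm⟩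
  obtain ⟨z, P, Q, hz, hQ, hPQ⟩ := hX.exists_int_series_of_mul_yFn_eq hf (by omega) hint hg₂ hg₃ hzy
  obtain ⟨F₁, G₁, D₁, D₂, hG₁0, hD₁, hD₂, hF₁, hD₁int, hD₂int⟩ :=
    hX.exists_rat_presentation hf (by omega) hrat hg₂ hg₃
  -- names
  set W₀ : WeierstrassCurve ℚ := { a₁ := 0, a₂ := 0, a₃ := 0, a₄ := a₄, a₆ := a₆ } with hW₀
  set Wc : WeierstrassCurve ℂ := { a₁ := 0, a₂ := 0, a₃ := 0, a₄ := (a₄ : ℂ), a₆ := (a₆ : ℂ) } with hWc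
  have hmapW : W₀.map (algebraMap ℚ ℂ) = Wc := by
    simp [hW₀, hWc, WeierstrassCurve.map]
  set acp := qExpansion 1 (⇑F) with hacp
  set b := qExpansion 1 (⇑G) with hb
  set a₁ := qExpansion 1 (⇑F₁) with ha₁
  set b₁ := qExpansion 1 (⇑G₁) with hb₁
  have hF0 : (F : ModularForm (Gamma0 N) k) ≠ 0 := hX.numerator_ne_zero hf
  have hG₁0' : (G₁ : ModularForm (Gamma0 N) k) ≠ 0 := by
    intro h0; apply hG₁0; apply DFunLike.ext; intro τ; exact DFunLike.congr_fun h0 τ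
  have hb0 : b ≠ 0 := qExpansion_ne_zero_of_ne_zero hX.modularForm_ne_zero
  have hb₁0 : b₁ ≠ 0 := qExpansion_ne_zero_of_ne_zero hG₁0'
  have inj : Function.Injective (fun p : ℂ⟦X⟧ ↦ (p : LaurentSeries ℂ)) :=
    HahnSeries.ofPowerSeries_injective
  -- `a₁ b = b₁ a` (both present `x`)
  have hR : a₁ * b = b₁ * acp := by
    apply inj
    change ((a₁ * b : ℂ⟦X⟧) : LaurentSeries ℂ) = ((b₁ * acp : ℂ⟦X⟧) : LaurentSeries ℂ)
    rw [PowerSeries.coe_mul, PowerSeries.coe_mul, ← hF₁, ← hX.coe_xFn_mul]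
    ring
  -- `b₁ · X_E(zc) = zc² · a₁`
  set Xc : ℂ⟦X⟧ := Wc.formalXMulSq.subst zc with hXc
  have hXE' : b * Xc = zc ^ 2 * acp := hXE
  have hX₁ : b₁ * Xc = zc ^ 2 * a₁ := by
    have key : b * (b₁ * Xc - zc ^ 2 * a₁) = 0 := by
      linear_combination b₁ * hXE' - zc ^ 2 * hR
    exact sub_eq_zero.mp ((mul_eq_zero.mp key).resolve_left hb0)
  -- integral models `A = D₂ a₁`, `B = D₁ b₁`
  obtain ⟨A, hA⟩ := IsXPresentation.exists_int_series_of_int_mul_cuspCoeff hD₂int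
  obtain ⟨B, hB⟩ := IsXPresentation.exists_int_series_of_int_mul_cuspCoeff hD₁int
  rw [← ha₁] at hA
  rw [← hb₁] at hB
  set Q₂ : ℤ⟦X⟧ := C (D₂ : ℤ) * B * Q ^ 2 with hQ₂
  set P₂ : ℤ⟦X⟧ := C (D₁ : ℤ) * A * P ^ 2 with hP₂
  -- the map `ℚ⟦X⟧ → ℂ⟦X⟧` is injective, and `ℤ → ℚ → ℂ = ℤ → ℂ`
  have hinj : Function.Injective (PowerSeries.map (algebraMap ℚ ℂ)) := by
    intro u v huv
    ext n
    have := congrArg (coeff n) huv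
    rw [coeff_map, coeff_map] at this
    exact (algebraMap ℚ ℂ).injective this
  have hmm : ∀ φ : ℤ⟦X⟧, (φ.map (Int.castRingHom ℚ)).map (algebraMap ℚ ℂ) = φ.map (Int.castRingHom ℂ) := by
    intro φ; ext n; simp [coeff_map]
  have hzs : HasSubst z := by
    refine HasSubst.of_constantCoeff_zero' ?_
    have h0 := hzc0
    rw [← hz, ← coeff_zero_eq_constantCoeff, coeff_map, coeff_zero_eq_constantCoeff] at h0
    exact (map_eq_zero (algebraMap ℚ ℂ)).mp h0
  -- `zc · Qc = Pc` over `ℂ`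
  have hPQc : zc * Q.map (Int.castRingHom ℂ) = P.map (Int.castRingHom ℂ) := by
    have h := congrArg (PowerSeries.map (algebraMap ℚ ℂ)) hPQ
    rwa [map_mul, hz, hmm, hmm] at h
  -- `X_E(z)` maps to `Xc`
  have hXmap : PowerSeries.map (algebraMap ℚ ℂ) (W₀.formalXMulSq.subst z) = Xc := by
    rw [powerSeries_map_subst hzs (algebraMap ℚ ℂ), WeierstrassCurve.map_formalXMulSq, hmapW, hz]
  refine ⟨z, P, Q, P₂, Q₂, ?_, hQ, hPQ, ?_, ?_, ?_⟩
  · have h0 := hzc0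
    rw [← hz, ← coeff_zero_eq_constantCoeff, coeff_map, coeff_zero_eq_constantCoeff] at h0
    exact (map_eq_zero (algebraMap ℚ ℂ)).mp h0
  · -- `Q₂ ≠ 0`
    have hB0 : B ≠ 0 := by
      intro h0
      have h1 : C (D₁ : ℂ) * b₁ = 0 := by rw [← hB, h0, map_zero]
      rcases mul_eq_zero.mp h1 with h2 | h2
      · have hD : (D₁ : ℂ) ≠ 0 := by exact_mod_cast hD₁.ne'
        exact hD (by simpa using congrArg constantCoeff h2)
      · exact hb₁0 h2
    have hC0 : (C (D₂ : ℤ) : ℤ⟦X⟧) ≠ 0 := by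
      intro h0
      have := congrArg constantCoeff h0
      rw [constantCoeff_C, map_zero] at this
      exact hD₂.ne' (by exact_mod_cast this)
    rw [hQ₂]
    exact mul_ne_zero (mul_ne_zero hC0 hB0) (pow_ne_zero 2 hQ)
  · -- `X_E(z) · Q₂ = P₂`, checked over `ℂ`
    apply hinj
    rw [map_mul, hXmap, hmm, hmm, hQ₂, hP₂, map_mul, map_mul, map_pow, map_C, map_mul, map_mul,
      map_pow, map_C, hA, hB, eq_intCast, eq_intCast, Int.cast_natCast, Int.cast_natCast]
    linear_combination (C (D₂ : ℂ) * C (D₁ : ℂ) * (Q.map (Int.castRingHom ℂ)) ^ 2) * hX₁ +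
      (C (D₁ : ℂ) * C (D₂ : ℂ) * a₁ * (zc * Q.map (Int.castRingHom ℂ) + P.map (Int.castRingHom ℂ))) * hPQc
  · -- the logarithm, checked over `ℂ`
    apply hinj
    rw [powerSeries_map_subst hzs (algebraMap ℚ ℂ), W₀.map_formalLog (algebraMap ℚ ℂ), hmapW, hz, hlog]
    ext n
    rw [coeff_map, coeff_mk, coeff_mk, map_div₀, map_natCast, eq_ratCast, Rat.cast_intCast, ha]

end Literature.NumberTheory.EllipticCurves.HondaCongruence
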